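import Summits.CriticalPhenomena.Ising3DConformalLimit.Theses.PerfectScreening
import Summits.CriticalPhenomena.Ising3DConformalLimit.Theses.AnomalousForcesInteraction
import Summits.CriticalPhenomena.Ising3DConformalLimit.Theses.LatticeSDPCertificates
import Summits.CriticalPhenomena.Ising3DConformalLimit.Theorems.IsingEuclidUpgradeR4NonGaussianFatStep
import Summits.CriticalPhenomena.Ising3DConformalLimit.Theorems.PerfectScreeningGaussianLimitNotScreenedDefs
import Summits.CriticalPhenomena.Ising3DConformalLimit.Theorems.PerfectScreeningGaussianLimitNotScreenedDepletionBound
import Summits.CriticalPhenomena.Ising3DConformalLimit.Theorems.PerfectScreeningGaussianLimitNotScreenedDyadicShellSums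
import Summits.CriticalPhenomena.Ising3DConformalLimit.Theorems.PerfectScreeningGaussianLimitNotScreenedOneArmAsymptotics
import Summits.CriticalPhenomena.Ising3DConformalLimit.Theorems.PerfectScreeningGaussianLimitNotScreenedClusterMomentsBox
import Summits.CriticalPhenomena.Ising3DConformalLimit.Theorems.GaussianLimitNotScreened.Negative.Reformulation
import Literature.Probability.LatticeModels.SourcedDoubleCurrents
import Literature.Probability.LatticeModels.CurrentsPartialMonotonicity
import Literature.Probability.LatticeModels.CriticalTwoPointDCPLowerTorus
import Literature.Probability.LatticeModels.PointwiseScalingLimitTwoPointMono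
import Literature.Probability.LatticeModels.PointwiseScalingLimitEtaExists
import HarnessLib

/-!
# Crux `GaussianLimitNotScreened` (stmt-CriticalPhenomena-13886), line `karamata-amplitude-blind-merging`:
# the FAT SPREAD CLUSTER is a theorem, and the crux follows from the two open inputs (capacity + corner)

Line lead prover-line-stmt-CriticalPhenomena-13886-0, 2026-08-16 (published skeleton
`Cruxes/GaussianLimitNotScreened/Lines/karamata_amplitude_blind_merging.lean`). Finite volume throughout (free box
`Λ_L ⊂ ℤ³` at `β_c(3)`; vocabulary of the landed `PerfectScreeningGaussianLimitNotScreenedDefs` and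
`IsingEuclidUpgradeR4NonGaussianDefs` modules: `traceCluster`, `defectG`, `rieszEnergy`, `IsSpreadDefect`,
`oneArmMoment₁/₂`, `energyMoment`, `lat`, `boxG`, `twoCurrentMeet`, `ScaleCovariantOn`).

* `stub_fatSpreadCluster` (registered sub-goal of the crux, the planner's STUB 2, PROVED): for a non-degenerate
  pointwise scaling limit of `criticalCorr 3` (`ρ > 0` on `(0,1]`), scale covariant on non-coincident
  configurations with exponent `Δ`, every `0 < s < 3 − 2Δ` and non-coincident quadruple `x`, with probability
  `≥ c > 0` under `P^{x̃₀x̃₁,∅}_{Λ_L}` the sourced double-current cluster of `x̃₀` contains a SPREAD `s`-DIMENSIONAL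
  DEFECT relative to `(x̃₂, x̃₃)` — Paley–Zygmund ∧ Markov in the box (landed `stub_clusterMomentsBox`, mass level
  `M₁/2`, energy level `(8c₂/c₁)R^{−s}M₁²`) fed by the counting-region asymptotics (landed `stub_oneArmAsymptotics`:
  `M₁² ≥ c₁M₂ > 0`, `E_s ≤ c₂R^{−s}M₁²`, `2Rˢ ≤ M₁`).
* `twoCurrentMeet_lower_of_capacity`, `hasNontrivialU4_of_lt_threeQuarters_of_capacity`: GIVEN the capacity of
  spread free defects (the line's open registered stub `stub_isingCapacity`, written out as an explicit hypothesis),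
  the landed depletion bound (`stub_depletionBound`, ADC21 Lemma A.1 as an equality) and Griffiths monotonicity turn
  the fat spread cluster into `P² ≥ c'c` below `Δ = 3/4`, hence `U₄^S ≢ 0` by the landed Aizenman criterion
  `hasNontrivialU4_of_twoCurrentMeet_lower`.
* `gaussianLimitNotScreened_of_capacity_of_corner` (+ `…_of_windowBelowHalf`): the
  crux `PerfectScreening.GaussianLimitNotScreened` from the capacity and the marginal corner `Δ = 3/4` (the line's
  other open stub `stub_noMarginalGaussianLimit`, discharged by item stmt-CriticalPhenomena-5507 or
  stmt-CriticalPhenomena-2601 through `noMarginalGaussianLimit_of_windowBelowHalf` /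
  `noMarginalGaussianLimit_of_gaussianLimitIsFree`, proved here). These are CONDITIONAL theorems (they credit
  nothing); they record kernel-checked what exactly remains of the crux on this line.
* Glue: `defectG_anti` (Griffiths), `tendsto_norm_latticeApprox_sub_atTop`, `isFiniteMeasure_sourcedDoubleCurrentLaw`;
  the window `dimension_window_and_eta` is the landed `Negative/Reformulation` theorem.

References: M. Aizenman, H. Duminil-Copin, Ann. Math. 194 (2021) = arXiv:1912.07973, §3 (3.11), §4.2 Lemma 4.4,
App. A (Lemma A.1, Prop. A.3); M. Aizenman, Comm. Math. Phys. 86 (1982); H. Duminil-Copin, R. Panis,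
arXiv:2404.05700 Thm 1.5; P. Mattila (1995) ch. 8.
-/

noncomputable section

open Filter Topology Set Function MeasureTheory Finset
open Literature.Probability.LatticeModels Literature.Probability.Percolation
open Summit.CriticalPhenomena.Ising3DConformalLimit.Cruxes.IsingEuclidUpgradeR4NonGaussian.FreeCovarianceDeltaDichotomy
  (lat boxG twoCurrentMeet ScaleCovariantOn eventually_lat_mem_box hasNontrivialU4_of_twoCurrentMeet_lower
    threePointRatio twoStep doubleCurrentMeasure_zero_or_prob)
open Summit.CriticalPhenomena.Ising3DConformalLimit.GaussianLimitNotScreenedNegative (dimension_window_and_eta)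
open scoped symmDiff

namespace Summit.CriticalPhenomena.Ising3DConformalLimit.Cruxes.GaussianLimitNotScreened.KaramataAmplitudeBlindMerging

/-! ## Proved glue -/

/-- Scale covariance of a Möbius-covariant family, restricted to non-coincident configurations. [folklore] -/
theorem scaleCovariantOn_of_isMoebiusCovariant {Δ : ℝ} {S : CorrFamily 3}
    (hM : IsMoebiusCovariant Δ S) : ScaleCovariantOn Δ S :=
  fun n c hc x _ => hM.isScaleCovariant n c hc x

/-- Griffiths volume monotonicity for the defect two-point function: enlarging the defect only
depletes more. [cite: FriedliVelenik2017, Exercise 3.12] -/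
theorem defectG_anti {L : ℕ} {C C' : Finset (Site 3)} (hCC' : C' ⊆ C) {c e : Site 3}
    (hc : c ∈ box 3 L) (he : e ∈ box 3 L) (hcC : c ∉ C) (heC : e ∉ C) :
    defectG L C c e ≤ defectG L C' c e := by
  unfold defectG
  refine DCPLower.isingTwoPoint_free_le_of_subset (zdGraph 3) (criticalBeta_nonneg (d := 3))
    (Finset.sdiff_subset_sdiff (Finset.Subset.refl _) hCC') ?_ ?_
  · exact Finset.mem_sdiff.2 ⟨hc, hcC⟩
  · exact Finset.mem_sdiff.2 ⟨he, heC⟩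

/-- The lattice points of two distinct macroscopic points drift apart: `‖[p/δ] − [q/δ]‖ → ∞` as
`δ → 0⁺`. [folklore] -/
theorem tendsto_norm_latticeApprox_sub_atTop {p q : EuclideanSpace ℝ (Fin 3)} (hpq : p ≠ q) :
    Tendsto (fun δ : ℝ => (‖latticeApprox δ p - latticeApprox δ q‖ : ℝ)) (𝓝[>] (0:ℝ)) atTop := by
  have hpos : 0 < ‖WithLp.ofLp p - WithLp.ofLp q‖ := by
    rw [norm_pos_iff, sub_ne_zero]
    intro h
    exact hpq (by simpa using congrArg (WithLp.toLp 2) h)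
  -- lower bound `‖p - q‖_∞ / δ - 2 ≤ ‖[p/δ] - [q/δ]‖`
  have hlow : ∀ᶠ δ in 𝓝[>] (0:ℝ), ‖WithLp.ofLp p - WithLp.ofLp q‖ / δ - 2 ≤
      (‖latticeApprox δ p - latticeApprox δ q‖ : ℝ) := by
    filter_upwards [self_mem_nhdsWithin] with δ hδ
    rw [Site.norm_eq_supNorm]
    exact le_supNorm_latticeApprox_sub (d := 3) (by norm_num) hδ p q
  have hdiv : Tendsto (fun δ : ℝ => ‖WithLp.ofLp p - WithLp.ofLp q‖ / δ - 2) (𝓝[>] (0:ℝ)) atTop := by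
    have h1 : Tendsto (fun δ : ℝ => ‖WithLp.ofLp p - WithLp.ofLp q‖ / δ) (𝓝[>] (0:ℝ)) atTop :=
      Tendsto.const_mul_atTop hpos tendsto_inv_nhdsGT_zero |>.congr fun δ => by ring
    exact tendsto_atTop_add_const_right _ (-2) h1 |>.congr fun δ => by ring
  exact tendsto_atTop_mono' _ hlow hdiv

/-- The box law of the trace of a sourced double current is a finite measure (a probability measure, or
the junk zero measure). [cite: AizenmanDuminilCopinAnnals2021, §3.1] -/
theorem isFiniteMeasure_sourcedDoubleCurrentLaw (L : ℕ) (A B : Finset (Site 3)) :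
    IsFiniteMeasure (sourcedDoubleCurrentLaw 3 L (criticalBeta 3) A B) := by
  unfold sourcedDoubleCurrentLaw
  rcases doubleCurrentMeasure_zero_or_prob (freeBoxGraph 3 L) (criticalBeta_nonneg 3)
      (boxSources 3 L A) (boxSources 3 L B) with h | h
  · rw [h, Measure.map_zero]; infer_instance
  · infer_instance

/-- **Registered stub `stub_fatSpreadCluster` — FAT SPREAD CLUSTER, PROVED (the planner's STUB 2; from the landed
`stub_clusterMomentsBox` + `stub_oneArmAsymptotics`).** For a non-degenerate
pointwise scaling limit of `criticalCorr 3` (`ρ > 0` on `(0,1]`), scale covariant on non-coincident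
configurations with exponent `Δ`, every `0 < s < 3 − 2Δ` and every non-coincident quadruple `x`: there
are `K, λ, ν, c > 0` such that for all small `δ` and then all large `L`, with probability `≥ c` under
`P^{x̃₀x̃₁,∅}_{Λ_L}` the double cluster of `x̃₀` contains a spread `s`-dimensional defect relative to
`(x̃₂, x̃₃)` avoiding `x̃₂, x̃₃` — namely `C(x̃₀) ∩ A(δ)` on the Paley–Zygmund ∧ Markov event of STUB 2a at
mass level `M₁/2` and energy level `t = (8c₂/c₁)R^{−s}M₁²`, whose probability is `≥ c₁/8` by STUB 2c.
[cite: AizenmanDuminilCopinAnnals2021, §4.2 Lemma 4.4 and App. A Prop. A.3] -/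
theorem stub_fatSpreadCluster :
    ∀ (ρ : ℝ → ℝ) (S : CorrFamily 3) (Δ : ℝ), (∀ δ ∈ Set.Ioc (0:ℝ) 1, 0 < ρ δ) →
      HasPointwiseScalingLimit (criticalCorr 3) ρ S → IsNondegenerateTwoPoint S →
      ScaleCovariantOn Δ S → ∀ s : ℝ, 0 < s → s < 3 - 2 * Δ →
      ∀ x ∈ NonCoincident 3 4, ∃ K lam nu : ℝ, 0 < K ∧ 0 < lam ∧ 0 < nu ∧ ∃ c : ℝ, 0 < c ∧
        ∀ᶠ δ in 𝓝[>] (0:ℝ), ∀ᶠ L : ℕ in atTop,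
          c ≤ (sourcedDoubleCurrentLaw 3 L (criticalBeta 3) ({lat δ x 0} ∆ {lat δ x 1}) ∅).real
            {ω | ∃ C ⊆ traceCluster L ω (lat δ x 0), lat δ x 2 ∉ C ∧ lat δ x 3 ∉ C ∧
              IsSpreadDefect s K lam nu (lat δ x 2) (lat δ x 3) C} := by
  intro ρ S Δ hρ hlim hnd hcov s hs₀ hs x hx
  obtain ⟨K, c₁, c₂, hK, hc₁, hc₂, A, hev⟩ :=
    stub_oneArmAsymptotics ρ S Δ hρ hlim hnd hcov s hs₀ hs x hx
  refine ⟨K, 32 * c₂ / c₁, 1, hK, by positivity, one_pos, c₁ / 8, by positivity, ?_⟩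
  have hinj : Function.Injective x := hx
  have h23 : x 2 ≠ x 3 := fun h => absurd (hinj h) (by decide)
  have hsep : ∀ᶠ δ in 𝓝[>] (0:ℝ), (1:ℝ) ≤ ‖lat δ x 2 - lat δ x 3‖ :=
    (tendsto_norm_latticeApprox_sub_atTop h23).eventually (eventually_ge_atTop 1)
  filter_upwards [hev, hsep] with δ hδ hR1
  filter_upwards [hδ, eventually_lat_mem_box δ x ∅] with L hL hbox
  obtain ⟨hAbox, h2, h3, hrad, hM₂pos, hPZ, hEn, hmass⟩ := hL
  -- abbreviations
  set a := lat δ x 0 with ha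
  set b := lat δ x 1 with hb
  set p := lat δ x 2 with hp
  set q := lat δ x 3 with hq
  set M₁ : ℝ := oneArmMoment₁ L a b (A δ) with hM₁
  set M₂ : ℝ := oneArmMoment₂ L a b (A δ) with hM₂
  set E : ℝ := energyMoment L a b s (A δ) with hE
  set R : ℝ := ‖p - q‖ with hR
  have hRpos : 0 < R := lt_of_lt_of_le one_pos hR1
  have hRs : 0 < R ^ s := Real.rpow_pos_of_pos hRpos s
  have hRns : 0 < R ^ (-s) := Real.rpow_pos_of_pos hRpos (-s)
  have hM₁pos : 0 < M₁ := lt_of_lt_of_le (by positivity) hmass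
  -- the energy level
  set t : ℝ := 8 * c₂ / c₁ * R ^ (-s) * M₁ ^ 2 with ht
  have htpos : 0 < t := by rw [ht]; positivity
  -- STUB 2a at mass level `M₁/2` and energy level `t`
  have h2a := stub_clusterMomentsBox L a b (hbox.1 0) (hbox.1 1) (A δ) hAbox s (M₁ / 2) t htpos
    (by linarith) (by linarith)
  have hPZ' : c₁ / 4 ≤ (M₁ - M₁ / 2) ^ 2 / M₂ := by
    rw [le_div_iff₀ hM₂pos]
    nlinarith [hPZ]
  have hMk : E / t ≤ c₁ / 8 := by
    rw [div_le_iff₀ htpos]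
    calc E ≤ c₂ * R ^ (-s) * M₁ ^ 2 := hEn
      _ = c₁ / 8 * t := by rw [ht]; field_simp
  have hP : c₁ / 8 ≤ (sourcedDoubleCurrentLaw 3 L (criticalBeta 3) ({a} ∆ {b}) ∅).real
      {ω | M₁ / 2 ≤ ((traceCluster L ω a ∩ A δ).card : ℝ) ∧
        rieszEnergy s (traceCluster L ω a ∩ A δ) ≤ t} := by
    linarith
  haveI := isFiniteMeasure_sourcedDoubleCurrentLaw L ({a} ∆ {b}) ∅
  refine hP.trans (measureReal_mono ?_ (measure_ne_top _ _))
  rintro ω ⟨hm, hI⟩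
  refine ⟨traceCluster L ω a ∩ A δ, Finset.inter_subset_left, ?_, ?_, ?_⟩
  · exact fun h => h2 (Finset.mem_inter.1 h).2
  · exact fun h => h3 (Finset.mem_inter.1 h).2
  refine ⟨fun u hu => hrad u (Finset.mem_inter.1 hu).2, ?_, ?_⟩
  · -- mass: `1 · Rˢ ≤ M₁/2 ≤ #C`
    rw [one_mul]
    linarith
  · -- energy: `I_s ≤ t = (8c₂/c₁) R^{-s} M₁² ≤ (32c₂/c₁) R^{-s} #C²`
    have hcard : M₁ ^ 2 ≤ 4 * ((traceCluster L ω a ∩ A δ).card : ℝ) ^ 2 := by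
      nlinarith [hM₁pos.le, hm]
    calc rieszEnergy s (traceCluster L ω a ∩ A δ) ≤ t := hI
      _ = 8 * c₂ / c₁ * R ^ (-s) * M₁ ^ 2 := rfl
      _ ≤ 8 * c₂ / c₁ * R ^ (-s) * (4 * ((traceCluster L ω a ∩ A δ).card : ℝ) ^ 2) :=
          mul_le_mul_of_nonneg_left hcard (by positivity)
      _ = 32 * c₂ / c₁ * R ^ (-s) * ((traceCluster L ω a ∩ A δ).card : ℝ) ^ 2 := by ring

/-- **ENGINE OUTPUT, CONDITIONAL ON THE CAPACITY**: below `Δ = 3/4`, the landed stubs 1–2 and the capacity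
hypothesis (the open registered stub `stub_isingCapacity`, taken here as an explicit hypothesis) give `P² ≥ κ > 0` at
`[x/δ]` for small `δ` and large `L`, at every non-coincident quadruple. [cite: AizenmanDuminilCopinAnnals2021, eq. (3.11) and App. A Lemma A.1] -/
theorem twoCurrentMeet_lower_of_capacity
    (hcap : (∀ s : ℝ, 3 / 2 < s → ∀ K lam nu : ℝ, 0 < K → 0 < lam → 0 < nu →
        ∃ c' : ℝ, 0 < c' ∧ c' ≤ 1 ∧ ∃ R₀ : ℝ, ∀ c e : Site 3, R₀ ≤ ‖c - e‖ →
          ∀ᶠ L : ℕ in atTop, ∀ C : Finset (Site 3), c ∉ C → e ∉ C →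
            IsSpreadDefect s K lam nu c e C → defectG L C c e ≤ (1 - c') * boxG L c e))
    {ρ : ℝ → ℝ} {S : CorrFamily 3} {Δ : ℝ}
    (hρ : ∀ δ ∈ Set.Ioc (0:ℝ) 1, 0 < ρ δ) (hlim : HasPointwiseScalingLimit (criticalCorr 3) ρ S)
    (hnd : IsNondegenerateTwoPoint S) (hcov : ScaleCovariantOn Δ S) (hΔ : Δ < 3 / 4)
    {x : Fin 4 → EuclideanSpace ℝ (Fin 3)} (hx : x ∈ NonCoincident 3 4) :
    ∃ κ : ℝ, 0 < κ ∧ ∀ᶠ δ in 𝓝[>] (0:ℝ), ∀ᶠ L : ℕ in atTop,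
      κ ≤ twoCurrentMeet L (lat δ x 0) (lat δ x 1) (lat δ x 2) (lat δ x 3) := by
  -- the Frostman exponent strictly between `3/2` and the cluster dimension `3 - 2Δ`
  set s : ℝ := (3 / 2 + (3 - 2 * Δ)) / 2 with hs
  have hs₁ : 3 / 2 < s := by rw [hs]; linarith
  have hs₂ : s < 3 - 2 * Δ := by rw [hs]; linarith
  have hs₀ : 0 < s := by linarith
  -- STUB 2: the spread sub-defect of the double cluster, with probability `≥ c`
  obtain ⟨K, lam, nu, hK, hlam, hnu, c, hc, hfat⟩ :=
    stub_fatSpreadCluster ρ S Δ hρ hlim hnd hcov s hs₀ hs₂ x hx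
  -- STUB 3: spread defects deplete, uniformly
  obtain ⟨c', hc', hc'1, R₀, hcapR⟩ := hcap s hs₁ K lam nu hK hlam hnu
  refine ⟨c' * c, mul_pos hc' hc, ?_⟩
  -- the pair `(x̃₂, x̃₃)` is eventually `R₀`-separated
  have hinj : Function.Injective x := hx
  have h23 : x 2 ≠ x 3 := fun h => absurd (hinj h) (by decide)
  have hsep : ∀ᶠ δ in 𝓝[>] (0:ℝ), R₀ ≤ ‖lat δ x 2 - lat δ x 3‖ :=
    (tendsto_norm_latticeApprox_sub_atTop h23).eventually (eventually_ge_atTop R₀)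
  filter_upwards [hfat, hsep] with δ hfatδ hsepδ
  have hcapδ := hcapR (lat δ x 2) (lat δ x 3) hsepδ
  filter_upwards [hfatδ, hcapδ, eventually_lat_mem_box δ x ∅] with L hL hcapL hbox
  -- depletion of every cluster containing a spread defect: STUB 3 + Griffiths monotonicity
  have hgood : ∀ C₀ : Finset (Site 3),
      (∃ C ⊆ C₀, lat δ x 2 ∉ C ∧ lat δ x 3 ∉ C ∧ IsSpreadDefect s K lam nu (lat δ x 2) (lat δ x 3) C) →
      lat δ x 2 ∉ C₀ → lat δ x 3 ∉ C₀ → C₀ ⊆ box 3 (L + 1) →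
      defectG L C₀ (lat δ x 2) (lat δ x 3) ≤ (1 - c') * boxG L (lat δ x 2) (lat δ x 3) := by
    rintro C₀ ⟨C, hCC₀, h2, h3, hspread⟩ h2₀ h3₀ -
    calc defectG L C₀ (lat δ x 2) (lat δ x 3) ≤ defectG L C (lat δ x 2) (lat δ x 3) :=
          defectG_anti hCC₀ (hbox.1 2) (hbox.1 3) h2₀ h3₀
      _ ≤ (1 - c') * boxG L (lat δ x 2) (lat δ x 3) := hcapL C h2 h3 hspread
  -- STUB 1 with the class `good C₀ := C₀ ⊇ some spread defect avoiding x̃₂, x̃₃`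
  have hdep := stub_depletionBound L (lat δ x 0) (lat δ x 1) (lat δ x 2) (lat δ x 3)
    (hbox.1 0) (hbox.1 1) (hbox.1 2) (hbox.1 3)
    (fun C₀ => ∃ C ⊆ C₀, lat δ x 2 ∉ C ∧ lat δ x 3 ∉ C ∧
      IsSpreadDefect s K lam nu (lat δ x 2) (lat δ x 3) C)
    c' hc'.le hc'1 hgood
  calc c' * c ≤ c' * (sourcedDoubleCurrentLaw 3 L (criticalBeta 3) ({lat δ x 0} ∆ {lat δ x 1}) ∅).real
        {ω | ∃ C ⊆ traceCluster L ω (lat δ x 0), lat δ x 2 ∉ C ∧ lat δ x 3 ∉ C ∧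
          IsSpreadDefect s K lam nu (lat δ x 2) (lat δ x 3) C} :=
        mul_le_mul_of_nonneg_left hL hc'.le
    _ ≤ _ := hdep

/-- **CAPACITY ⇒ NON-GAUSSIAN below `Δ = 3/4`** (landed stubs + capacity hypothesis + the landed Aizenman criterion
`hasNontrivialU4_of_twoCurrentMeet_lower`): every non-degenerate pointwise limit of `criticalCorr 3`,
scale covariant on non-coincident configurations with `Δ < 3/4`, has `U₄ ≢ 0`. The amplitude-blind
statement of the card: it covers the Coulomb corner, the screened corner `Δ = 1/2, ℓ → 0` and all of
`(1/2, 3/4)` at once. [cite: Aizenman1982, §1 and §5] -/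
theorem hasNontrivialU4_of_lt_threeQuarters_of_capacity
    (hcap : (∀ s : ℝ, 3 / 2 < s → ∀ K lam nu : ℝ, 0 < K → 0 < lam → 0 < nu →
        ∃ c' : ℝ, 0 < c' ∧ c' ≤ 1 ∧ ∃ R₀ : ℝ, ∀ c e : Site 3, R₀ ≤ ‖c - e‖ →
          ∀ᶠ L : ℕ in atTop, ∀ C : Finset (Site 3), c ∉ C → e ∉ C →
            IsSpreadDefect s K lam nu c e C → defectG L C c e ≤ (1 - c') * boxG L c e))
    {ρ : ℝ → ℝ} {S : CorrFamily 3} {Δ : ℝ}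
    (hρ : ∀ δ ∈ Set.Ioc (0:ℝ) 1, 0 < ρ δ) (hlim : HasPointwiseScalingLimit (criticalCorr 3) ρ S)
    (hnd : IsNondegenerateTwoPoint S) (hcov : ScaleCovariantOn Δ S) (hΔ : Δ < 3 / 4) :
    HasNontrivialU4 S := by
  -- the reference non-coincident quadruple `0, e₀, 2e₀, 3e₀`
  have hx : (fun i : Fin 4 => ((i : ℕ) : ℝ) • EuclideanSpace.single (0 : Fin 3) (1:ℝ)) ∈
      NonCoincident 3 4 := by
    intro i j hij
    have he : (EuclideanSpace.single (0 : Fin 3) (1:ℝ)) ≠ 0 := by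
      intro h
      have := congrArg (fun v : EuclideanSpace ℝ (Fin 3) => v 0) h
      simp at this
    have h := smul_left_injective ℝ he hij
    have h' : (i : ℕ) = (j : ℕ) := by exact_mod_cast h
    exact Fin.ext h'
  obtain ⟨κ, hκ, hev⟩ := twoCurrentMeet_lower_of_capacity hcap hρ hlim hnd hcov hΔ hx
  exact hasNontrivialU4_of_twoCurrentMeet_lower hlim hnd hx hκ hev

/-! ## The composition, conditional on the two open inputs (capacity + marginal corner) -/

/-- **`GaussianLimitNotScreened` from the CAPACITY and the MARGINAL CORNER.** Let `(ρ, Δ, S)` satisfy the crux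
hypotheses. By the window theorem `Δ ∈ [1/2, 3/4]`; if `Δ < 3/4` the engine
(`hasNontrivialU4_of_lt_threeQuarters_of_capacity`) gives `U₄^S ≢ 0` against the Gaussian hypothesis; if
`Δ = 3/4` the corner hypothesis does. Both hypotheses are open registered stubs of the line
(`stub_isingCapacity`, `stub_noMarginalGaussianLimit`), written out verbatim; the corner is discharged by either
existing item below. (Conditional theorem: credits nothing by itself.) [cite: AizenmanDuminilCopinAnnals2021, eq. (3.11), Lemma 4.4 and App. A Lemma A.1] -/
theorem gaussianLimitNotScreened_of_capacity_of_corner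
    (hcap : (∀ s : ℝ, 3 / 2 < s → ∀ K lam nu : ℝ, 0 < K → 0 < lam → 0 < nu →
        ∃ c' : ℝ, 0 < c' ∧ c' ≤ 1 ∧ ∃ R₀ : ℝ, ∀ c e : Site 3, R₀ ≤ ‖c - e‖ →
          ∀ᶠ L : ℕ in atTop, ∀ C : Finset (Site 3), c ∉ C → e ∉ C →
            IsSpreadDefect s K lam nu c e C → defectG L C c e ≤ (1 - c') * boxG L c e))
    (hcorner : (∀ (ρ : ℝ → ℝ) (S : CorrFamily 3), (∀ δ ∈ Set.Ioc (0:ℝ) 1, 0 < ρ δ) →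
        HasPointwiseScalingLimit (criticalCorr 3) ρ S → IsNondegenerateTwoPoint S →
        IsMoebiusCovariant (3 / 4) S → HasNontrivialU4 S)) :
    Summit.CriticalPhenomena.Ising3DConformalLimit.Theses.PerfectScreening.GaussianLimitNotScreened := by
  intro ρ Δ S hρ hlim hnd hM hU4 _hscr
  obtain ⟨hwin, -⟩ := dimension_window_and_eta hρ hlim hnd hM.isScaleCovariant
  by_cases hlt : Δ < 3 / 4
  · exact hU4 (hasNontrivialU4_of_lt_threeQuarters_of_capacity hcap hρ hlim hnd
      (scaleCovariantOn_of_isMoebiusCovariant hM) hlt)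
  · have hΔ : Δ = 3 / 4 := le_antisymm hwin.2 (not_lt.1 hlt)
    subst hΔ
    exact hU4 (hcorner ρ S hρ hlim hnd hM)

/-! ## Discharging the marginal corner from existing items (proved reductions) -/

/-- The corner from item stmt-CriticalPhenomena-2601 `GaussianLimitIsFree` (route
AnomalousForcesInteraction): a Gaussian Möbius limit would have `Δ = 1/2 ≠ 3/4`. [cite: Kotani1973, Theorem 2] -/
theorem noMarginalGaussianLimit_of_gaussianLimitIsFree
    (hfree : Summit.CriticalPhenomena.Ising3DConformalLimit.Theses.AnomalousForcesInteraction.GaussianLimitIsFree) :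
    ∀ (ρ : ℝ → ℝ) (S : CorrFamily 3), (∀ δ ∈ Set.Ioc (0:ℝ) 1, 0 < ρ δ) →
      HasPointwiseScalingLimit (criticalCorr 3) ρ S → IsNondegenerateTwoPoint S →
      IsMoebiusCovariant (3 / 4) S → HasNontrivialU4 S := by
  intro ρ S hρ hlim hnd hM
  by_contra hU4
  have h := hfree ρ (3 / 4) S hρ hlim hnd hM.isEuclideanInvariant.1 hM.isScaleCovariant hU4
  norm_num at h

/-- The corner from `η(3) ≠ 1/2`: a non-degenerate scale-covariant limit with `Δ = 3/4` forces
`η = 2Δ − 1 = 1/2` to exist (`dimension_window_and_eta`). [cite: DuminilCopinPanis2025LowerBounds, Theorem 1.5] -/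
theorem noMarginalGaussianLimit_of_eta_ne_half (hη : ¬ HasIsingExponentEta 3 (1 / 2)) :
    ∀ (ρ : ℝ → ℝ) (S : CorrFamily 3), (∀ δ ∈ Set.Ioc (0:ℝ) 1, 0 < ρ δ) →
      HasPointwiseScalingLimit (criticalCorr 3) ρ S → IsNondegenerateTwoPoint S →
      IsMoebiusCovariant (3 / 4) S → HasNontrivialU4 S := by
  intro ρ S hρ hlim hnd hM
  obtain ⟨-, h⟩ := dimension_window_and_eta hρ hlim hnd hM.isScaleCovariant
  exact absurd (by convert h using 2; norm_num) hη

/-- Item stmt-CriticalPhenomena-5507 `WindowBelowHalf` (the axial two-point function never loses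
more than the power `3/2 − ε` between two scales) excludes `η = 1/2`. [cite: DuminilCopinPanis2025LowerBounds, Theorem 1.3 and Theorem 1.5] -/
theorem eta_ne_half_of_windowBelowHalf
    (hwin : Summit.CriticalPhenomena.Ising3DConformalLimit.Theses.LatticeSDPCertificates.WindowBelowHalf) :
    ¬ HasIsingExponentEta 3 (1 / 2) := by
  intro hη
  obtain ⟨ε, c, hε, hc, hw⟩ := hwin
  -- along the axis: `log G(n e₁) / log n → -(3/2)`
  have hinj : Function.Injective (fun n : ℕ => (Pi.single 0 (n:ℤ) : Site 3)) := by
    intro a b hab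
    have := congr_fun hab 0
    simpa using this
  have hax : Tendsto (fun n : ℕ => Real.log (criticalTwoPoint 3 (Pi.single 0 (n:ℤ))) / Real.log (n:ℝ))
      atTop (𝓝 (-((3:ℝ) - 2 + 1 / 2))) := by
    have h1 := (hη.comp (hinj.tendsto_cofinite.mono_left Nat.cofinite_eq_atTop.ge))
    refine h1.congr' (Eventually.of_forall fun n => ?_)
    simp only [Function.comp_apply, norm_single_axis, Int.cast_natCast, Nat.abs_cast]
  -- the window with `m = 1`: `log G(n e₁) ≥ log (c G(e₁)) - (3/2 - ε) log n`
  set g₁ : ℝ := criticalTwoPoint 3 (Pi.single 0 ((1:ℕ):ℤ)) with hg₁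
  have hg₁pos : 0 < g₁ := criticalTwoPoint_axis_pos 1
  have hlow : ∀ᶠ n : ℕ in atTop, -((3:ℝ) / 2 - ε) + Real.log (c * g₁) / Real.log n ≤
      Real.log (criticalTwoPoint 3 (Pi.single 0 (n:ℤ))) / Real.log (n:ℝ) := by
    filter_upwards [eventually_ge_atTop 2] with n hn
    have hn1 : (1:ℕ) ≤ n := by omega
    have hnpos : (0:ℝ) < n := by positivity
    have hlogn : 0 < Real.log (n:ℝ) := Real.log_pos (by exact_mod_cast hn)
    have hwn := hw 1 n le_rfl hn1
    have hGpos : 0 < criticalTwoPoint 3 (Pi.single 0 (n:ℤ)) := criticalTwoPoint_axis_pos n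
    -- `c * n^{-(3/2-ε)} * g₁ ≤ G(n e₁)`, take logs
    have hdiv1 : ((n:ℝ) / (1:ℕ)) = n := by simp
    rw [hdiv1] at hwn
    have hlhs : 0 < c * (n:ℝ) ^ (-((3:ℝ) / 2 - ε)) * g₁ := by positivity
    have hlog := Real.log_le_log hlhs hwn
    rw [Real.log_mul (by positivity) hg₁pos.ne', Real.log_mul hc.ne' (by positivity),
      Real.log_rpow hnpos] at hlog
    have key : -((3:ℝ) / 2 - ε) + Real.log (c * g₁) / Real.log n =
        (Real.log c + -((3:ℝ) / 2 - ε) * Real.log n + Real.log g₁) / Real.log n := by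
      rw [Real.log_mul hc.ne' hg₁pos.ne']
      field_simp
      ring
    rw [key]
    exact div_le_div_of_nonneg_right hlog hlogn.le
  -- the lower bound tends to `-(3/2 - ε)`, the sequence to `-3/2`: contradiction
  have hlim : Tendsto (fun n : ℕ => -((3:ℝ) / 2 - ε) + Real.log (c * g₁) / Real.log n) atTop
      (𝓝 (-((3:ℝ) / 2 - ε) + 0)) :=
    tendsto_const_nhds.add (tendsto_const_nhds.div_atTop (Real.tendsto_log_atTop.comp
      tendsto_natCast_atTop_atTop))
  have := le_of_tendsto_of_tendsto hlim hax hlow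
  norm_num at this
  linarith

/-- Hence the corner from item stmt-CriticalPhenomena-5507. [cite: DuminilCopinPanis2025LowerBounds, Theorem 1.5] -/
theorem noMarginalGaussianLimit_of_windowBelowHalf
    (hwin : Summit.CriticalPhenomena.Ising3DConformalLimit.Theses.LatticeSDPCertificates.WindowBelowHalf) :
    ∀ (ρ : ℝ → ℝ) (S : CorrFamily 3), (∀ δ ∈ Set.Ioc (0:ℝ) 1, 0 < ρ δ) →
      HasPointwiseScalingLimit (criticalCorr 3) ρ S → IsNondegenerateTwoPoint S →
      IsMoebiusCovariant (3 / 4) S → HasNontrivialU4 S :=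
  noMarginalGaussianLimit_of_eta_ne_half (eta_ne_half_of_windowBelowHalf hwin)

/-- **Items-level dividend**: CAPACITY + item stmt-CriticalPhenomena-5507 `WindowBelowHalf` ⇒ the crux.
[cite: DuminilCopinPanis2025LowerBounds, Theorem 1.5] -/
theorem gaussianLimitNotScreened_of_capacity_of_windowBelowHalf
    (hcap : (∀ s : ℝ, 3 / 2 < s → ∀ K lam nu : ℝ, 0 < K → 0 < lam → 0 < nu →
        ∃ c' : ℝ, 0 < c' ∧ c' ≤ 1 ∧ ∃ R₀ : ℝ, ∀ c e : Site 3, R₀ ≤ ‖c - e‖ →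
          ∀ᶠ L : ℕ in atTop, ∀ C : Finset (Site 3), c ∉ C → e ∉ C →
            IsSpreadDefect s K lam nu c e C → defectG L C c e ≤ (1 - c') * boxG L c e))
    (hwin : Summit.CriticalPhenomena.Ising3DConformalLimit.Theses.LatticeSDPCertificates.WindowBelowHalf) :
    Summit.CriticalPhenomena.Ising3DConformalLimit.Theses.PerfectScreening.GaussianLimitNotScreened :=
  gaussianLimitNotScreened_of_capacity_of_corner hcap (noMarginalGaussianLimit_of_windowBelowHalf hwin)

end Summit.CriticalPhenomena.Ising3DConformalLimit.Cruxes.GaussianLimitNotScreened.KaramataAmplitudeBlindMerging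

end
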